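import Literature.Geometry.Riemannian.MCFMetricEvolution
import Literature.Geometry.Riemannian.GaussianShrinker
import HarnessLib

/-!
# Area dissipation along a smooth cylinder flow, part 1: normal variations of immersions of any
# codimension — evolution of the induced metric and of the area element

Part 1 of the proof of the registered stub `stub_areaDissipation` of line `killing-flux` of the
crux `CylinderEntropy.CylinderRungTwo` (stmt-SmoothPoincare4-7631): along a smooth mean curvature
flow `IsCylinderMCF M F ν T` of closed cross-sections of `N = S⁴ × ℝ ⊂ ℝ⁶` the area
`μH⁴(F_t(M))` is non-increasing (part 2, `CylinderEntropyCylinderRungTwoAreaDissipation.lean`).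
The cross-sections have codimension TWO in `ℝ⁶`, whereas the tree's metric-evolution file
`Literature/Geometry/Riemannian/MCFMetricEvolution.lean` (`IsClassicalMCF.hasDerivAt_inducedBilin`,
`IsClassicalMCF.hasDerivAt_sqrt_det_gram`) is dimension-locked to hypersurfaces `Nⁿ → ℝⁿ⁺¹`. This
file ports those computations verbatim to immersions `F_t : N → W` of a manifold `N` (boundaryless
finite-dimensional model `I'`) into ANY finite-dimensional real inner product space `W`, for a
one-parameter family `F` jointly smooth on `U × N` (`U ⊆ ℝ` open) whose velocity at the time `t₀` is
NORMAL, `∂ₜF(t₀, ·) = -φ ν₀` with `ν₀ : N → W` a smooth field normal to `F t₀` and `φ : N → ℝ` any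
function (for mean curvature flow `φ = H`; nothing about `φ` is differentiated):

* `hasDerivAt_inducedBilin_self_of_normalVelocity` — `d/dt|_{t₀} (F_t^*δ)_p(u, u) = -2 φ(p) K_{ν₀}(u, u)`
  (variation `Φ(t, s) = F(t, c_u(s))` along the chart-straight curve `c_u`, mixed partials
  `∂ₜ∂ₛΦ = ∂ₛ∂ₜΦ` (`MixedPartials.lean`), and the derivative at `s = 0` of the orthogonality
  `⟪∂ₜΦ(t₀, s), ∂ₛΦ(t₀, s)⟫ = 0`, with `K(u, u) = -⟪ν₀, (F_{t₀} ∘ c_u)''(0)⟫`,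
  `secondFundamentalForm_self_eq_neg_inner` of `EuclideanHypersurfaceContact.lean`, any codimension);
* `hasDerivAt_inducedBilin_of_normalVelocity` — polarised form `-φ (K(u, w) + K(w, u))`;
* `hasDerivAt_sqrt_det_gram_of_normalVelocity` — **first variation of the area element**: for
  `F t₀` an immersion and any basis `β` of `T_p N`,
  `d/dt|_{t₀} √det ((F_t^*δ)(βᵢ, βⱼ)) = -φ(p) H(p) √det ((F_{t₀}^*δ)(βᵢ, βⱼ))`, `H = tr_{F_{t₀}^*δ} K_{ν₀}`
  the tree's scalar mean curvature (Jacobi's formula, `JacobiFormula.lean`, and the trace formula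
  `trace_eq_sum_mul_inv_gram`); for `φ = H` this is Huisken's `∂ₜ μ_t = -H² μ_t`;
* `stub_areaDissipation_part1` — the registered sub-goal marker of this helper file: the last
  theorem for Euclidean model spaces `N` modelled on `ℝᵐ`, `W = ℝᵏ`.

Everything is PROVED (no `sorry`, no new definitions, no named facts).

References: G. Huisken, *Flow by mean curvature of convex surfaces into spheres*, J. Differential
Geom. 20 (1984) 237–266, Lemma 3.2 and §3; C. Mantegazza, *Lecture Notes on Mean Curvature Flow*,
Birkhäuser 2011, Prop. 2.3.1, Prop. 2.3.3 (the computations are literally the same in any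
codimension for a normal speed `-φ ν₀`).
-/

-- the prescribed namespace `Summit.SmoothPoincare4.SmoothPoincare4.…` repeats `SmoothPoincare4`
set_option linter.dupNamespace false

noncomputable section

open Bundle Set Function Filter Module
open scoped Manifold ContDiff Topology RealInnerProductSpace Matrix

namespace Summit.SmoothPoincare4.SmoothPoincare4.Cruxes.CylinderRungTwo.KillingFlux

open Literature.Geometry.Riemannian Literature.Geometry.Riemannian.EuclideanHypersurface
open Literature.Geometry.Lorentzian Literature.Geometry.Lorentzian.PseudoRiemannianMetric
open Literature.Analysis.Calculus

/-! ## Normal variations of immersions into a Euclidean space: evolution of the induced metric -/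

section NormalVariation

variable {E' : Type*} [NormedAddCommGroup E'] [NormedSpace ℝ E'] {H' : Type*} [TopologicalSpace H']
  {I' : ModelWithCorners ℝ E' H'} {N : Type*} [TopologicalSpace N] [ChartedSpace H' N]
  {W : Type*} [NormedAddCommGroup W] [InnerProductSpace ℝ W]
  {F : ℝ → N → W} {U : Set ℝ}

/-- Space slices of a jointly smooth family are smooth. [folklore] -/
theorem contMDiff_slice_of_contMDiffOn
    (hF : ContMDiffOn (𝓘(ℝ, ℝ).prod I') 𝓘(ℝ, W) ∞ (fun p : ℝ × N => F p.1 p.2) (U ×ˢ univ))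
    {t : ℝ} (ht : t ∈ U) : ContMDiff I' 𝓘(ℝ, W) ∞ (F t) :=
  hF.comp_contMDiff (f := fun y : N => (t, y)) (contMDiff_const.prodMk contMDiff_id)
    fun _ => ⟨ht, mem_univ _⟩

variable [I'.Boundaryless] [IsManifold I' ∞ N]

/-- **The variation `Φ(t, s) = F(t, c(s))` along a chart-straight curve is jointly `C^∞`** at
`(t₀, s)` whenever `t₀ ∈ U` and the chart point of `c(s)` lies in the chart target. [folklore] -/
theorem contDiffAt_normalVariation (hU : IsOpen U)
    (hF : ContMDiffOn (𝓘(ℝ, ℝ).prod I') 𝓘(ℝ, W) ∞ (fun p : ℝ × N => F p.1 p.2) (U ×ˢ univ))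
    {t₀ : ℝ} (ht₀ : t₀ ∈ U) (p : N) (u : TangentSpace I' p) {s : ℝ}
    (hs : extChartAt I' p p + s • (show E' from u) ∈ (extChartAt I' p).target) :
    ContDiffAt ℝ ∞ (fun q : ℝ × ℝ => F q.1 (curveThrough I' p u q.2)) (t₀, s) := by
  have h1 : ContMDiffAt (𝓘(ℝ, ℝ).prod I') 𝓘(ℝ, W) ∞ (fun q : ℝ × N => F q.1 q.2)
      (t₀, curveThrough I' p u s) :=
    hF.contMDiffAt ((hU.prod isOpen_univ).mem_nhds ⟨ht₀, mem_univ _⟩)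
  have hsnd : ContMDiffAt 𝓘(ℝ, ℝ × ℝ) 𝓘(ℝ, ℝ) ∞ (Prod.snd : ℝ × ℝ → ℝ) (t₀, s) :=
    contDiff_snd.contMDiff.contMDiffAt
  have hfst : ContMDiffAt 𝓘(ℝ, ℝ × ℝ) 𝓘(ℝ, ℝ) ∞ (Prod.fst : ℝ × ℝ → ℝ) (t₀, s) :=
    contDiff_fst.contMDiff.contMDiffAt
  have hc : ContMDiffAt 𝓘(ℝ, ℝ × ℝ) I' ∞ (fun q : ℝ × ℝ => curveThrough I' p u q.2) (t₀, s) :=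
    ContMDiffAt.comp (t₀, s) (g := curveThrough I' p u) (f := (Prod.snd : ℝ × ℝ → ℝ))
      (EuclideanHypersurface.contMDiffAt_curveThrough p u hs) hsnd
  have h2 : ContMDiffAt 𝓘(ℝ, ℝ × ℝ) (𝓘(ℝ, ℝ).prod I') ∞
      (fun q : ℝ × ℝ => (q.1, curveThrough I' p u q.2)) (t₀, s) :=
    hfst.prodMk hc
  exact (h1.comp (t₀, s) h2).contDiffAt

variable [FiniteDimensional ℝ W] [FiniteDimensional ℝ E']

/-- **Evolution of the induced metric under a normal variation, diagonal form.** Let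
`F : U × N → W` be jointly smooth (`U ⊆ ℝ` open), `t₀ ∈ U`, `ν₀ : N → W` a smooth field normal to
`F t₀`, and suppose the velocity at time `t₀` is normal, `∂ₜF(t₀, y) = -φ(y) ν₀(y)`. Then for
`p ∈ N`, `u ∈ T_p N`,

  `d/dt|_{t₀} (F_t^*δ)_p(u, u) = -2 φ(p) K_{ν₀}(u, u)`

(`K` the tree's second fundamental form, `K_ν(v, w) = ⟪D_v ν, dF w⟫`). Proof WITHOUT
differentiating `φ`: along the variation `Φ(t, s) = F(t, c_u(s))`, `dF_t u = ∂ₛΦ(t, 0)`, its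
`t`-derivative is the mixed derivative `∂ₜ∂ₛΦ = ∂ₛ∂ₜΦ`, and differentiating the orthogonality
`⟪∂ₜΦ(t₀, s), ∂ₛΦ(t₀, s)⟫ = 0` at `s = 0` gives `⟪∂ₛ∂ₜΦ, dF u⟫ = φ ⟪ν₀, (F_{t₀} ∘ c_u)''(0)⟫ =
-φ K(u, u)`. This is Huisken's `∂ₜ g_{ij} = -2 H h_{ij}` (1984, Lemma 3.2) for `φ = H`, in any
codimension for the chosen normal. [cite: Huisken1984, Lemma 3.2] [cite: Mantegazza2011, Prop. 2.3.1] -/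
theorem hasDerivAt_inducedBilin_self_of_normalVelocity (hU : IsOpen U)
    (hF : ContMDiffOn (𝓘(ℝ, ℝ).prod I') 𝓘(ℝ, W) ∞ (fun p : ℝ × N => F p.1 p.2) (U ×ˢ univ))
    {t₀ : ℝ} (ht₀ : t₀ ∈ U) {ν₀ : N → W} (hν : ContMDiff I' 𝓘(ℝ, W) ∞ ν₀)
    (hn : (euclideanMetric W).IsNormalTo I' (F t₀) ν₀) {φ : N → ℝ}
    (hvel : ∀ y, deriv (fun s => F s y) t₀ = -(φ y) • ν₀ y) (p : N) (u : TangentSpace I' p) :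
    HasDerivAt (fun t => (euclideanMetric W).inducedBilin I' (F t) p u u)
      (-2 * φ p * (euclideanMetric W).secondFundamentalForm I' (F t₀) ν₀ p u u) t₀ := by
  have hsl : ∀ t ∈ U, ContMDiff I' 𝓘(ℝ, W) ∞ (F t) := fun t ht =>
    contMDiff_slice_of_contMDiffOn hF ht
  -- the variation and its joint smoothness at `(t₀, 0)`
  set Φ : ℝ × ℝ → W := fun q => F q.1 (curveThrough I' p u q.2) with hΦdef
  have hs0 : extChartAt I' p p + (0 : ℝ) • (show E' from u) ∈ (extChartAt I' p).target := by
    rw [zero_smul, add_zero]; exact mem_extChartAt_target p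
  have hΦ : ContDiffAt ℝ 2 Φ (t₀, 0) :=
    (contDiffAt_normalVariation hU hF ht₀ p u hs0).of_le (by norm_cast)
  set X : W := fderiv ℝ (fderiv ℝ Φ) (t₀, 0) ((1 : ℝ), (0 : ℝ)) ((0 : ℝ), (1 : ℝ)) with hX
  -- (1) `t ↦ d(F_t)_p u` has derivative `X` at `t₀`
  have hX1 := hasDerivAt_deriv_curry_right_mixed hΦ
  have heq : (fun t => deriv (fun s => Φ (t, s)) 0) =ᶠ[𝓝 t₀] fun t =>
      (mfderiv I' 𝓘(ℝ, W) (F t) p : TangentSpace I' p →L[ℝ] W) u := by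
    filter_upwards [hU.mem_nhds ht₀] with t ht
    exact (hasDerivAt_comp_curveThrough_zero (hsl t ht) p u).deriv
  have hdF : HasDerivAt (fun t => (mfderiv I' 𝓘(ℝ, W) (F t) p :
      TangentSpace I' p →L[ℝ] W) u) X t₀ :=
    hX1.congr_of_eventuallyEq heq.symm
  -- (2) `s ↦ ∂ₜΦ(t₀, s)` has derivative `X` at `0`
  have hX2 : HasDerivAt (fun s => deriv (fun t => Φ (t, s)) t₀) X 0 :=
    hasDerivAt_deriv_curry_left_mixed hΦ
  -- the velocity along the curve: `∂ₜΦ(t₀, s) = -φ(c s) ν₀(c s)`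
  set w : ℝ → W := fun s => ν₀ (curveThrough I' p u s) with hw
  have hvel' : ∀ s, deriv (fun t => Φ (t, s)) t₀ = (-(φ (curveThrough I' p u s))) • w s := by
    intro s
    simp only [hΦdef, hw]
    exact hvel _
  -- (3) orthogonality `⟪∂ₜΦ(t₀, s), ∂ₛΦ(t₀, s)⟫ = 0` near `s = 0`
  have horth : (fun s => ⟪deriv (fun t => Φ (t, s)) t₀, deriv (fun s' => Φ (t₀, s')) s⟫) =ᶠ[𝓝 0]
      fun _ => (0 : ℝ) := by
    filter_upwards [eventually_lineThrough_mem_target p u] with s hs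
    rw [hvel' s]
    have hn' : ⟪w s, (mfderiv I' 𝓘(ℝ, W) (F t₀) (curveThrough I' p u s) :
        TangentSpace I' _ →L[ℝ] W) (velocity I' (curveThrough I' p u) s)⟫ = 0 := by
      have := hn (curveThrough I' p u s) (velocity I' (curveThrough I' p u) s)
      rwa [euclideanMetric_apply] at this
    have hd' : deriv (fun s' => Φ (t₀, s')) s = (mfderiv I' 𝓘(ℝ, W) (F t₀)
        (curveThrough I' p u s) : TangentSpace I' _ →L[ℝ] W)
        (velocity I' (curveThrough I' p u) s) :=
      (hasDerivAt_comp_curveThrough (hsl t₀ ht₀) p u hs).deriv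
    rw [hd', real_inner_smul_left, hn', mul_zero]
  -- (4) differentiate the orthogonality at `s = 0`
  have hβ0 : ContDiffAt ℝ ∞ (fun s' => Φ (t₀, s')) 0 :=
    (eventually_contDiffAt_comp_curveThrough (hsl t₀ ht₀) p u).self_of_nhds
  have hβ2 := hasDerivAt_deriv_of_contDiffAt hβ0
  have hprod := hX2.inner ℝ hβ2
  have hzero : deriv (fun s => ⟪deriv (fun t => Φ (t, s)) t₀, deriv (fun s' => Φ (t₀, s')) s⟫) 0
      = 0 := by
    rw [horth.deriv_eq, deriv_const]
  rw [hprod.deriv] at hzero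
  -- `hzero : ⟪∂ₜΦ(t₀,0), β''(0)⟫ + ⟪X, β'(0)⟫ = 0`
  have hβ1 : deriv (fun s' => Φ (t₀, s')) 0 =
      (mfderiv I' 𝓘(ℝ, W) (F t₀) p : TangentSpace I' p →L[ℝ] W) u :=
    (hasDerivAt_comp_curveThrough_zero (hsl t₀ ht₀) p u).deriv
  have hK : (euclideanMetric W).secondFundamentalForm I' (F t₀) ν₀ p u u =
      -⟪ν₀ p, deriv (deriv (fun s' => Φ (t₀, s'))) 0⟫ :=
    secondFundamentalForm_self_eq_neg_inner (hsl t₀ ht₀) hν hn p u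
  have hv0 : deriv (fun t => Φ (t, 0)) t₀ = (-(φ p)) • w 0 := by
    rw [hvel' 0, curveThrough_zero]
  have hw0 : w 0 = ν₀ p := by
    show ν₀ (curveThrough I' p u 0) = ν₀ p
    rw [curveThrough_zero]
  rw [← hw0] at hK
  rw [hv0, hβ1, real_inner_smul_left] at hzero
  -- (5) the derivative of `g_t(u, u) = ⟪dF_t u, dF_t u⟫`
  have hXu : ⟪X, (mfderiv I' 𝓘(ℝ, W) (F t₀) p : TangentSpace I' p →L[ℝ] W) u⟫ =
      -(φ p) * (euclideanMetric W).secondFundamentalForm I' (F t₀) ν₀ p u u := by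
    have hK' : (euclideanMetric W).secondFundamentalForm I' (F t₀) ν₀ p u u =
        -⟪w 0, deriv (deriv fun s' => Φ (t₀, s')) 0⟫ := hK
    rw [hK']
    linarith [hzero]
  have hfun : (fun t => (euclideanMetric W).inducedBilin I' (F t) p u u) =
      fun t => ⟪(mfderiv I' 𝓘(ℝ, W) (F t) p : TangentSpace I' p →L[ℝ] W) u,
        (mfderiv I' 𝓘(ℝ, W) (F t) p : TangentSpace I' p →L[ℝ] W) u⟫ := by
    funext t
    rw [inducedBilin_apply, euclideanMetric_apply]
  rw [hfun]
  refine (hdF.inner ℝ hdF).congr_deriv ?_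
  have hXu' := (real_inner_comm X ((mfderiv I' 𝓘(ℝ, W) (F t₀) p :
      TangentSpace I' p →L[ℝ] W) u)).trans hXu
  rw [hXu', hXu]
  ring


/-- **Evolution of the induced metric under a normal variation**:
`d/dt|_{t₀} (F_t^*δ)_p(u, w) = -φ(p) (K_{ν₀}(u, w) + K_{ν₀}(w, u))` (`= -2 φ K(u, w)`, `K` being
symmetric) — polarisation of `hasDerivAt_inducedBilin_self_of_normalVelocity`.
[cite: Huisken1984, Lemma 3.2] [cite: Mantegazza2011, Prop. 2.3.1] -/
theorem hasDerivAt_inducedBilin_of_normalVelocity (hU : IsOpen U)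
    (hF : ContMDiffOn (𝓘(ℝ, ℝ).prod I') 𝓘(ℝ, W) ∞ (fun p : ℝ × N => F p.1 p.2) (U ×ˢ univ))
    {t₀ : ℝ} (ht₀ : t₀ ∈ U) {ν₀ : N → W} (hν : ContMDiff I' 𝓘(ℝ, W) ∞ ν₀)
    (hn : (euclideanMetric W).IsNormalTo I' (F t₀) ν₀) {φ : N → ℝ}
    (hvel : ∀ y, deriv (fun s => F s y) t₀ = -(φ y) • ν₀ y) (p : N) (u w : TangentSpace I' p) :
    HasDerivAt (fun t => (euclideanMetric W).inducedBilin I' (F t) p u w)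
      (-(φ p) * ((euclideanMetric W).secondFundamentalForm I' (F t₀) ν₀ p u w +
        (euclideanMetric W).secondFundamentalForm I' (F t₀) ν₀ p w u)) t₀ := by
  set B : ℝ → (TangentSpace I' p →L[ℝ] TangentSpace I' p →L[ℝ] ℝ) := fun t =>
    (euclideanMetric W).inducedBilin I' (F t) p with hB
  set K := (euclideanMetric W).secondFundamentalForm I' (F t₀) ν₀ p with hKdef
  -- symmetry and polarisation of the induced form
  have hsymm : ∀ t, B t u w = B t w u := fun t => by
    simp only [hB]
    rw [inducedBilin_apply, inducedBilin_apply, euclideanMetric_apply, euclideanMetric_apply]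
    exact real_inner_comm _ _
  have hpol : (fun t => B t u w) = fun t =>
      (1 / 2 : ℝ) * (B t (u + w) (u + w) - B t u u - B t w w) := by
    funext t
    simp only [map_add, FunLike.coe_add, Pi.add_apply, ← hsymm t]
    ring
  have h1 := hasDerivAt_inducedBilin_self_of_normalVelocity hU hF ht₀ hν hn hvel p (u + w)
  have h2 := hasDerivAt_inducedBilin_self_of_normalVelocity hU hF ht₀ hν hn hvel p u
  have h3 := hasDerivAt_inducedBilin_self_of_normalVelocity hU hF ht₀ hν hn hvel p w
  have hKpol : K (u + w) (u + w) = K u u + K u w + K w u + K w w := by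
    simp only [map_add, LinearMap.add_apply]
    ring
  have hgoal : (fun t => (euclideanMetric W).inducedBilin I' (F t) p u w) = fun t => B t u w := rfl
  rw [hgoal, hpol]
  refine (((h1.sub h2).sub h3).const_mul (1 / 2 : ℝ)).congr_deriv ?_
  simp only [← hKdef]
  rw [hKpol]
  ring

/-- **Evolution of the area element under a normal variation**: with the hypotheses of
`hasDerivAt_inducedBilin_self_of_normalVelocity` and `F t₀` an immersion, for every basis `β` of
`T_p N` the Gram determinant `D(t) = det ((F_t^*δ)_p(βᵢ, βⱼ))` satisfies

  `d/dt|_{t₀} √D = -φ(p) H(p) √D(t₀)`,   `H = tr_{F_{t₀}^*δ} K_{ν₀}` the tree's mean curvature,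

i.e. the first variation of area `∂ₜ dμ_t = -φ H dμ_t` for the normal speed `-φ ν₀` (for mean
curvature flow, `φ = H`: Huisken's `∂ₜ μ_t = -H² μ_t`). Proof: `∂ₜ g_{ij} = -φ (K_{ij} + K_{ji})`,
Jacobi's formula `(√det G)' = ½ √det G · tr (G⁻¹ G')` (`JacobiFormula.lean`), symmetry of `G⁻¹` and
the trace formula `H = Σ K_{im} (G⁻¹)_{mi}` (`trace_eq_sum_mul_inv_gram`). [cite: Huisken1984, Lemma 3.2] [cite: Mantegazza2011, Prop. 2.3.3] -/
theorem hasDerivAt_sqrt_det_gram_of_normalVelocity (hU : IsOpen U)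
    (hF : ContMDiffOn (𝓘(ℝ, ℝ).prod I') 𝓘(ℝ, W) ∞ (fun p : ℝ × N => F p.1 p.2) (U ×ˢ univ))
    {t₀ : ℝ} (ht₀ : t₀ ∈ U) {ν₀ : N → W} (hν : ContMDiff I' 𝓘(ℝ, W) ∞ ν₀)
    (hn : (euclideanMetric W).IsNormalTo I' (F t₀) ν₀) {φ : N → ℝ}
    (hvel : ∀ y, deriv (fun s => F s y) t₀ = -(φ y) • ν₀ y)
    (hf : (euclideanMetric W).IsSpacelikeImmersion I' (F t₀)) (p : N) {ι : Type*} [Fintype ι]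
    [DecidableEq ι] (β : Module.Basis ι ℝ (TangentSpace I' p)) :
    HasDerivAt (fun t => Real.sqrt (Matrix.of fun i j =>
        (euclideanMetric W).inducedBilin I' (F t) p (β i) (β j)).det)
      (-(φ p * (euclideanMetric W).meanCurvature (F t₀) contMDiff_pullbackBilin_holds hf ν₀ p) *
        Real.sqrt (Matrix.of fun i j =>
          (euclideanMetric W).inducedBilin I' (F t₀) p (β i) (β j)).det) t₀ := by
  set g₁ := (euclideanMetric W).inducedMetric (F t₀) contMDiff_pullbackBilin_holds hf with hg₁
  set K := (euclideanMetric W).secondFundamentalForm I' (F t₀) ν₀ p with hKdef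
  set H := (euclideanMetric W).meanCurvature (F t₀) contMDiff_pullbackBilin_holds hf ν₀ p with hH
  -- the Gram curve and its derivative
  set A : ℝ → ι → ι → ℝ := fun t i j =>
    (euclideanMetric W).inducedBilin I' (F t) p (β i) (β j) with hA
  set A' : ι → ι → ℝ := fun i j => -(φ p) * (K (β i) (β j) + K (β j) (β i)) with hA'
  have hAd : HasDerivAt A A' t₀ :=
    hasDerivAt_pi.2 fun i => hasDerivAt_pi.2 fun j =>
      hasDerivAt_inducedBilin_of_normalVelocity hU hF ht₀ hν hn hvel p (β i) (β j)
  -- the Gram matrix at `t₀` is that of the Riemannian metric `g₁`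
  have hΓ : Matrix.of (A t₀) = Matrix.of fun i j => g₁.val p (β i) (β j) := by
    ext i j
    rw [Matrix.of_apply, Matrix.of_apply, hg₁, inducedMetric_val]
  have hpos : 0 < (Matrix.of (A t₀)).det := by
    rw [hΓ]
    have hmat : (Matrix.of fun i j => (g₁.toBilinForm p) (β i) (β j)) =
        Matrix.of fun i j => g₁.val p (β i) (β j) := by
      ext i j; rw [Matrix.of_apply, Matrix.of_apply, toBilinForm_apply]
    rw [← hmat]
    refine det_gram_pos β (g₁.toBilinForm p) (fun v w => ?_) (fun v hv => ?_)
    · rw [toBilinForm_apply, toBilinForm_apply]; exact g₁.symm p v w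
    · rw [toBilinForm_apply]; exact isRiemannian_inducedMetric _ _ _ _ p v hv
  -- Jacobi
  have hJ := hasDerivAt_sqrt_det (A' := (Matrix.of A' : Matrix ι ι ℝ)) hAd hpos
  -- the trace: `tr (Γ⁻¹ A') = -2 φ · tr_g K = -2 φ H`
  have htrK : H = ∑ i, ∑ m, K (β i) (β m) * (Matrix.of (A t₀))⁻¹ m i := by
    rw [hΓ, hH, meanCurvature]
    exact g₁.trace_eq_sum_mul_inv_gram p β K
  have hΓsymm : (Matrix.of (A t₀))ᵀ = Matrix.of (A t₀) := by
    ext i j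
    simp only [Matrix.transpose_apply, Matrix.of_apply, hA]
    rw [inducedBilin_apply, inducedBilin_apply, euclideanMetric_apply, euclideanMetric_apply]
    exact real_inner_comm _ _
  have hinvsymm : ∀ i m, (Matrix.of (A t₀))⁻¹ i m = (Matrix.of (A t₀))⁻¹ m i := fun i m => by
    have h1 : (Matrix.of (A t₀))⁻¹ i m = ((Matrix.of (A t₀))⁻¹)ᵀ m i := rfl
    rw [h1, Matrix.transpose_nonsing_inv, hΓsymm]
  have htr : ((Matrix.of (A t₀))⁻¹ * Matrix.of A').trace = -2 * φ p * H := by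
    have h1 : ((Matrix.of (A t₀))⁻¹ * Matrix.of A').trace =
        ∑ i, ∑ m, (Matrix.of (A t₀))⁻¹ i m * (-(φ p) * (K (β m) (β i) + K (β i) (β m))) := by
      simp only [Matrix.trace, Matrix.diag_apply, Matrix.mul_apply, Matrix.of_apply, hA']
    have h2 : ∑ i, ∑ m, (Matrix.of (A t₀))⁻¹ i m * K (β m) (β i) =
        ∑ i, ∑ m, K (β i) (β m) * (Matrix.of (A t₀))⁻¹ m i := by
      rw [Finset.sum_comm]
      exact Finset.sum_congr rfl fun i _ => Finset.sum_congr rfl fun m _ => mul_comm _ _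
    have h3 : ∑ i, ∑ m, (Matrix.of (A t₀))⁻¹ i m * K (β i) (β m) =
        ∑ i, ∑ m, K (β i) (β m) * (Matrix.of (A t₀))⁻¹ m i :=
      Finset.sum_congr rfl fun i _ => Finset.sum_congr rfl fun m _ => by rw [hinvsymm i m, mul_comm]
    have h4 : ∑ i, ∑ m, (Matrix.of (A t₀))⁻¹ i m * (-(φ p) * (K (β m) (β i) + K (β i) (β m))) =
        -(φ p) * (∑ i, ∑ m, (Matrix.of (A t₀))⁻¹ i m * K (β m) (β i) +
          ∑ i, ∑ m, (Matrix.of (A t₀))⁻¹ i m * K (β i) (β m)) := by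
      rw [← Finset.sum_add_distrib, Finset.mul_sum]
      refine Finset.sum_congr rfl fun i _ => ?_
      rw [← Finset.sum_add_distrib, Finset.mul_sum]
      exact Finset.sum_congr rfl fun m _ => by ring
    rw [h1, h4, h2, h3, ← htrK]
    ring
  refine hJ.congr_deriv ?_
  rw [htr]
  simp only [hA]
  ring

end NormalVariation

/-- **Registered sub-goal marker `stub_areaDissipation_part1` (first variation of the area element
under a normal variation, any codimension).** For a family `F : ℝ → N → ℝᵏ` of maps of an
`m`-manifold `N`, jointly smooth on `U × N` (`U` open, `t₀ ∈ U`), with `F t₀` an immersion, `ν₀` a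
smooth field normal to `F t₀` and normal velocity `∂ₜF(t₀, ·) = -φ ν₀`: for every `p ∈ N` and every
basis `β` of `T_p N`, `d/dt|_{t₀} √det ((F_t^*δ)_p(βᵢ, βⱼ)) = -φ(p) H(p) √det ((F_{t₀}^*δ)_p(βᵢ, βⱼ))`
(`hasDerivAt_sqrt_det_gram_of_normalVelocity`). [cite: Huisken1984, Lemma 3.2] [cite: Mantegazza2011, Prop. 2.3.3] -/
theorem stub_areaDissipation_part1 :
    ∀ (m k : ℕ) (N : Type) [TopologicalSpace N] [ChartedSpace (EuclideanSpace ℝ (Fin m)) N] [IsManifold (𝓡 m) ∞ N] (F : ℝ → N → EuclideanSpace ℝ (Fin k)) (U : Set ℝ) (t₀ : ℝ) (ν₀ : N → EuclideanSpace ℝ (Fin k)) (φ : N → ℝ) (hf : (Literature.Geometry.Riemannian.euclideanMetric (EuclideanSpace ℝ (Fin k))).IsSpacelikeImmersion (𝓡 m) (F t₀)), IsOpen U → t₀ ∈ U → ContMDiffOn (𝓘(ℝ, ℝ).prod (𝓡 m)) (𝓡 k) ∞ (fun p : ℝ × N => F p.1 p.2) (U ×ˢ Set.univ) → ContMDiff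 (𝓡 m) (𝓡 k) ∞ ν₀ → (Literature.Geometry.Riemannian.euclideanMetric (EuclideanSpace ℝ (Fin k))).IsNormalTo (𝓡 m) (F t₀) ν₀ → (∀ y, deriv (fun s => F s y) t₀ = -(φ y) • ν₀ y) → ∀ (p : N) (ι : Type) [Fintype ι] [DecidableEq ι] (β : Module.Basis ι ℝ (TangentSpace (𝓡 m) p)), HasDerivAt (fun t => Real.sqrt (Matrix.of fun i j => (Literature.Geometry.Riemannian.euclideanMetric (EuclideanSpace ℝ (Fin k))).inducedBilin (𝓡 m) (F t) p (β i) (β j)).det) (-(φ p * (Literature.Geometry.Riemannian.euclideanMetric (EuclideanSpace ℝ (Fin k))).meanCurvature (F t₀) Literature.Geometry.Lorentzian.PseudoRiemannianMetric.contMDiff_pullbackBilin_holds hf ν₀ p) * Real.sqrt (Matrix.of fun i j => (Literature.Geometry.Riemannian.euclideanMetric (EuclideanSpace ℝ (Fin k))).inducedBilin (𝓡 m) (F t₀) p (β i) (β j)).det) t₀ :=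
  fun _ _ _ _ _ _ _ _ _ _ _ hf hU ht₀ hF hν hn hvel p _ _ _ β =>
    hasDerivAt_sqrt_det_gram_of_normalVelocity hU hF ht₀ hν hn hvel hf p β

end Summit.SmoothPoincare4.SmoothPoincare4.Cruxes.CylinderRungTwo.KillingFlux

end
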